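import Summits.Langlands.Langlands.Statement
import Literature.NumberTheory.NumberFields.ArithmeticEquivalenceGassmannProofs
import Literature.NumberTheory.GaloisRepresentations.HeckeCharacterProofs
import Literature.NumberTheory.GaloisRepresentations.GaloisRepFrobeniusProofs
import Literature.NumberTheory.Automorphic.Sweep1SymmetricPowerAdelic
import HarnessLib

/-!
# Route `DedekindQuotient1951` (Langlands) — crux `DedekindQuotientEntire` (stmt-Langlands-17271),
# line `Sketch`, stub D `stub_piSide`

The π-side bookkeeping of the crux: from the cofinite Satake–Frobenius clause of
`Summit.Langlands.Corresponds`, the Frobenius hypothesis of the crux, uniqueness of Frobenius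
characteristic polynomials (`GaloisRep.HasFrobCharpolyAt.unique_holds`), the local identity of
stub A (taken as the hypothesis `hloc`) and the Godement–Jacquet input `PartialLEntire` (the crux's antecedent, taken UNFOLDED as the
hypothesis `hS4` so that this file need not import the route module) at `n = 4` with the finite exceptional set `S = {v : ¬ SatakeFrobCompatibleAt} ∪ {v : q_v ∈ {1951, ℓ}}`, we
obtain a finite set `T` of rational primes, `σ₀ : ℝ` and an ENTIRE `g₀` with
`∏_{p ∉ T} F_K(p, s) = g₀(s)` (as a `HasProd`) for `Re s > σ₀`, where
`F_K(p,s) = (∏_{f ∈ splittingType K p} (1 - p^{-fs})⁻¹)·(1 - p^{-s})`; places of `ℚ` are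
transported to `Nat.Primes` along Mathlib's `Rat.HeightOneSpectrum.primesEquiv`.
-/

set_option linter.dupNamespace false -- project-wide option; `Summit.Langlands.Langlands` is the mandated namespace

noncomputable section

open scoped NumberField
open Polynomial Complex Filter IsDedekindDomain
open Literature.NumberTheory.NumberFields Literature.NumberTheory.Automorphic
open Literature.NumberTheory.GaloisRepresentations

namespace Summit.Langlands.Langlands.Theorems.DedekindQuotientEntire

/-- `v ↦ q_v` is injective on the places of `ℚ` (`q_v = primesEquiv v`, tree
`residueCard_eq_primesEquiv`, and `primesEquiv` is a bijection). -/
theorem piSide_residueCard_injective :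
    Function.Injective fun v : HeightOneSpectrum (𝓞 ℚ) => v.residueCard := by
  intro v w h
  have h' : ((Rat.HeightOneSpectrum.primesEquiv v : Nat.Primes) : ℕ) =
      ((Rat.HeightOneSpectrum.primesEquiv w : Nat.Primes) : ℕ) := by
    simpa only [residueCard_eq_primesEquiv] using h
  exact (Rat.HeightOneSpectrum.primesEquiv (R := 𝓞 ℚ)).injective (Subtype.ext h')

/-- For a prime `q` and `Re s > 0`, `1 - q^{-s} ≠ 0` (indeed `‖q^{-s}‖ = q^{-Re s} < 1`). -/
theorem piSide_one_sub_cpow_ne_zero {q : ℕ} (hq : 1 < q) {s : ℂ} (hs : 0 < s.re) :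
    (1 : ℂ) - (q : ℂ) ^ (-s) ≠ 0 := by
  intro h
  have h1 : (q : ℂ) ^ (-s) = 1 := (sub_eq_zero.mp h).symm
  have hn : ‖(q : ℂ) ^ (-s)‖ < 1 := by
    rw [Complex.norm_natCast_cpow_of_pos (by omega) (-s), Complex.neg_re]
    exact Real.rpow_lt_one_of_one_lt_of_neg (by exact_mod_cast hq) (by linarith)
  rw [h1, norm_one] at hn
  exact lt_irrefl _ hn

/-- From the local identity `(1 - y)·∏_{a ∈ α}(1 - a y) = ∏_f (1 - y^f)` with `1 - y ≠ 0`: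
`(∏_{a ∈ α}(1 - a y))⁻¹ = (∏_f (1 - y^f)⁻¹)·(1 - y)`. -/
theorem piSide_inv_satakeFactor {α : Multiset ℂ} {fs : Multiset ℕ} {y : ℂ} (hy : (1 : ℂ) - y ≠ 0)
    (h : (1 - y) * (α.map fun a => 1 - a * y).prod = (fs.map fun f => 1 - y ^ f).prod) :
    ((α.map fun a => 1 - a * y).prod)⁻¹ = (fs.map fun f => (1 - y ^ f)⁻¹).prod * (1 - y) := by
  have hA : (α.map fun a => 1 - a * y).prod = (1 - y)⁻¹ * (fs.map fun f => 1 - y ^ f).prod := by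
    rw [← h, inv_mul_cancel_left₀ hy]
  rw [hA, mul_inv, inv_inv, Multiset.prod_map_inv, mul_comm]

/-- **Stub D (π-side bookkeeping).**  From the cofinite Satake clause of `Corresponds`, the
Frobenius hypothesis, uniqueness of Frobenius characteristic polynomials, the local identity (A)
and `PartialLEntire` at `n = 4` with `S = {¬ SatakeFrobCompatibleAt} ∪ {q_v ∈ {1951, ℓ}}`:
there are a finite set `T` of rational primes, `σ₀` and an entire `g₀` with
`HasProd_{p ∉ T} F_K(p,s) = g₀(s)` for `Re s > σ₀`. -/
theorem stub_piSide
    (hS4 : ∀ (n : ℕ), 2 ≤ n → ∀ (hcpt : isCompact_glFiniteIntegralLevel n ℚ)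
      (π : CuspidalAutomorphicRepData n ℚ hcpt) (S : Set (HeightOneSpectrum (𝓞 ℚ))), S.Finite →
      ∀ α : HeightOneSpectrum (𝓞 ℚ) → Multiset ℂ, (∀ v, v ∉ S → π.1.HasSatakeParamAt v (α v)) →
      ∃ (σ₀ : ℝ) (g : ℂ → ℂ), Differentiable ℂ g ∧ ∀ s : ℂ, σ₀ < s.re →
        HasProd (fun v : {v : HeightOneSpectrum (𝓞 ℚ) // v ∉ S} =>
          (((α v.1).map fun a : ℂ => 1 - a * ((v.1.residueCard : ℂ) ^ (-s))).prod)⁻¹) (g s))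
    (K : Type) [Field K] [NumberField K] (RD : Summit.Langlands.ReciprocityData ℚ) (ℓ : ℕ)
    [Fact ℓ.Prime] (ι : PadicAlgCl ℓ ≃+* ℂ) (hcpt : isCompact_glFiniteIntegralLevel 4 ℚ)
    (π : CuspidalAutomorphicRepData 4 ℚ hcpt) (ρ : FramedGaloisRep ℚ (PadicAlgCl ℓ) 4)
    (hfrob : ∀ v : HeightOneSpectrum (𝓞 ℚ), v.residueCard ≠ 1951 → v.residueCard ≠ ℓ →
      ρ.IsUnramifiedAt v ∧ ∃ Q : Polynomial (PadicAlgCl ℓ), ρ.HasFrobCharpolyAt v Q ∧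
        (X - C 1) * Q =
          (∏ 𝔭 ∈ (UniqueFactorizationMonoid.factors
              (Ideal.span {((v.residueCard : ℕ) : 𝓞 K)})).toFinset,
            (X ^ (𝔭.inertiaDeg ℤ) - 1 : ℤ[X])).map (Int.castRingHom (PadicAlgCl ℓ)))
    (hcorr : Summit.Langlands.Corresponds RD ι π.1 ρ)
    (hloc : ∀ {q : ℕ}, q.Prime → ∀ α : Multiset ℂ,
      (X - C 1) * arithFrobPolyOfSatake ι q 1 α =
        (∏ 𝔭 ∈ (UniqueFactorizationMonoid.factors (Ideal.span {((q : ℕ) : 𝓞 K)})).toFinset,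
          (X ^ (𝔭.inertiaDeg ℤ) - 1 : ℤ[X])).map (Int.castRingHom (PadicAlgCl ℓ)) →
      ∀ y : ℂ, (1 - y) * (α.map fun a => 1 - a * y).prod =
        ((splittingType K q).map fun f => 1 - y ^ f).prod) :
    ∃ (T : Finset Nat.Primes) (σ₀ : ℝ) (g₀ : ℂ → ℂ), Differentiable ℂ g₀ ∧
      ∀ s : ℂ, σ₀ < s.re →
        HasProd (fun p : {p : Nat.Primes // p ∉ T} =>
          ((splittingType K (p.1 : ℕ)).map fun f : ℕ => (1 - ((((p.1 : ℕ) : ℂ)) ^ (-s)) ^ f)⁻¹).prod *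
            (1 - (((p.1 : ℕ) : ℂ)) ^ (-s))) (g₀ s) := by
  classical
  -- the finite exceptional set of places of `ℚ`
  set S : Set (HeightOneSpectrum (𝓞 ℚ)) :=
    {v | ¬ Summit.Langlands.SatakeFrobCompatibleAt ι π.1 ρ v} ∪
      ((fun v : HeightOneSpectrum (𝓞 ℚ) => v.residueCard) ⁻¹' {1951, ℓ}) with hS
  have hSfin : S.Finite := by
    refine Set.Finite.union (Filter.eventually_cofinite.mp hcorr.1) ?_
    exact Set.Finite.preimage (piSide_residueCard_injective.injOn) (Set.toFinite _)
  have hgood : ∀ v, v ∉ S → Summit.Langlands.SatakeFrobCompatibleAt ι π.1 ρ v ∧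
      v.residueCard ≠ 1951 ∧ v.residueCard ≠ ℓ := by
    intro v hv
    simp only [hS, Set.mem_union, Set.mem_setOf_eq, Set.mem_preimage, Set.mem_insert_iff,
      Set.mem_singleton_iff, not_or, not_not] at hv
    exact ⟨hv.1, hv.2.1, hv.2.2⟩
  -- the Satake family off `S`
  let α : HeightOneSpectrum (𝓞 ℚ) → Multiset ℂ := fun v =>
    if h : v ∉ S then Classical.choose (hgood v h).1 else 0
  have hα : ∀ v (hv : v ∉ S), π.1.HasSatakeParamAt v (α v) ∧
      ρ.HasFrobCharpolyAt v (arithFrobPolyOfSatake ι v.residueCard 1 (α v)) := by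
    intro v hv
    have hspec := Classical.choose_spec (hgood v hv).1
    simp only [α, dif_pos hv]
    exact ⟨hspec.1, hspec.2.2⟩
  -- Godement–Jacquet input at `n = 4`
  obtain ⟨σ₀, g₀, hg₀, hprod⟩ := hS4 4 (by norm_num) hcpt π S hSfin α (fun v hv => (hα v hv).1)
  -- the local identity at every good place
  have hfac : ∀ v (hv : v ∉ S) (y : ℂ), (1 - y) * ((α v).map fun a => 1 - a * y).prod =
      ((splittingType K v.residueCard).map fun f => 1 - y ^ f).prod := by
    intro v hv y
    obtain ⟨-, h1951, hℓ⟩ := hgood v hv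
    obtain ⟨-, Q, hQ, hQeq⟩ := hfrob v h1951 hℓ
    have hQ' : Q = arithFrobPolyOfSatake ι v.residueCard 1 (α v) :=
      GaloisRep.HasFrobCharpolyAt.unique_holds
        ((FramedGaloisRep.hasFrobCharpolyAt_toGaloisRep_iff v _ ρ).mpr hQ)
        ((FramedGaloisRep.hasFrobCharpolyAt_toGaloisRep_iff v _ ρ).mpr (hα v hv).2)
    rw [hQ'] at hQeq
    have hprime : v.residueCard.Prime := by
      rw [Rat.residueCard_eq_natGenerator]
      exact Rat.HeightOneSpectrum.prime_natGenerator v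
    exact hloc hprime (α v) hQeq y
  -- transport to `Nat.Primes`
  set T : Finset Nat.Primes := hSfin.toFinset.image Rat.HeightOneSpectrum.primesEquiv with hT
  have hmemT : ∀ v : HeightOneSpectrum (𝓞 ℚ), v ∉ S ↔ Rat.HeightOneSpectrum.primesEquiv v ∉ T := by
    intro v
    rw [hT, Finset.mem_image]
    constructor
    · rintro hv ⟨w, hw, hwv⟩
      rw [Equiv.apply_eq_iff_eq] at hwv
      rw [hwv, Set.Finite.mem_toFinset] at hw
      exact hv hw
    · intro hv hvS
      exact hv ⟨v, (Set.Finite.mem_toFinset hSfin).mpr hvS, rfl⟩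
  let e' : {v : HeightOneSpectrum (𝓞 ℚ) // v ∉ S} ≃ {p : Nat.Primes // p ∉ T} :=
    (Rat.HeightOneSpectrum.primesEquiv (R := 𝓞 ℚ)).subtypeEquiv hmemT
  refine ⟨T, max σ₀ 0, g₀, hg₀, fun s hs => ?_⟩
  have hs₀ : σ₀ < s.re := lt_of_le_of_lt (le_max_left _ _) hs
  have hs0 : 0 < s.re := lt_of_le_of_lt (le_max_right _ _) hs
  have hP := hprod s hs₀
  -- the termwise identity: the Godement–Jacquet factor at `v` is `F_K(q_v, s)`
  have key : ∀ v : {v : HeightOneSpectrum (𝓞 ℚ) // v ∉ S},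
      ((splittingType K ((Rat.HeightOneSpectrum.primesEquiv v.1 : Nat.Primes) : ℕ)).map
          fun f : ℕ => (1 - ((((Rat.HeightOneSpectrum.primesEquiv v.1 : Nat.Primes) : ℕ) : ℂ) ^
            (-s)) ^ f)⁻¹).prod *
        (1 - (((Rat.HeightOneSpectrum.primesEquiv v.1 : Nat.Primes) : ℕ) : ℂ) ^ (-s)) =
      (((α v.1).map fun a : ℂ => 1 - a * ((v.1.residueCard : ℂ) ^ (-s))).prod)⁻¹ := by
    intro v
    rw [← residueCard_eq_primesEquiv v.1,
      piSide_inv_satakeFactor (piSide_one_sub_cpow_ne_zero v.1.one_lt_residueCard hs0)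
        (hfac v.1 v.2 _)]
  have hfun : ((fun p : {p : Nat.Primes // p ∉ T} =>
      ((splittingType K (p.1 : ℕ)).map fun f : ℕ => (1 - ((((p.1 : ℕ) : ℂ)) ^ (-s)) ^ f)⁻¹).prod *
        (1 - (((p.1 : ℕ) : ℂ)) ^ (-s))) ∘ e') =
      fun v => (((α v.1).map fun a : ℂ => 1 - a * ((v.1.residueCard : ℂ) ^ (-s))).prod)⁻¹ := by
    funext v
    exact key v
  rw [← e'.hasProd_iff, hfun]
  exact hP

end Summit.Langlands.Langlands.Theorems.DedekindQuotientEntire
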